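import Mathlib
import Summits.ValiantsHypothesis.ValiantsHypothesis.Theorems.ProofCarryingSymmetryRestorationQPACConverse
import Summits.ValiantsHypothesis.ValiantsHypothesis.Theorems.ProofCarryingSymmetryRestorationQPDistStability

/-!
# Route ProofCarryingSymmetry — the stability bet in its three equivalent forms

For the planner typing item stmt-ValiantsHypothesis-10358 (L, "stability of provable symmetry", the
route's bet): the birth form L (short `P_c` proofs of all invariance identities ⇒ a polynomially larger
`S_n`-SYMMETRIC circuit) and the line's registered bet S2⁗ (… ⇒ a polynomially larger circuit whose
renamed UNFOLDINGS are inter-derivable in `P_f` WITHOUT DISTRIBUTIVITY, units and constants allowed)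
are EQUIVALENT — `stabilityOfProvableSymmetry_iff_proofsToDistEquiv` — through the proved rungs S3⁗
(`stabilityAtDistEquiv`, worker A, cycle 2) and B-core″ (`proofsToACEquiv_of_stabilityOfProvableSymmetry`,
cycle 1).  (The intermediate cycle-1 form S2″ — no A6–A10 — sits between them.)  Everything proved.
-/

-- single-problem summit: `Summit.ValiantsHypothesis.ValiantsHypothesis.…` is the namespace by design (D-0017)
set_option linter.dupNamespace false

namespace Summit.ValiantsHypothesis.ValiantsHypothesis.Theorems

open Literature.Computability.AlgebraicComplexity

/-- **L ⟺ S2⁗**: the route's stability bet (symmetric circuit from short invariance proofs) is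
equivalent to distributivity elimination from invariance proofs up to AC + units + constants of the
unfolding, at polynomial cost in the circuit. (⇒): lay the symmetric circuit out (B-core″) — its
renamed unfoldings are even AC-equivalent; (⇐): normalise units/constants, take the AC-canonical
symmetric circuit (S3⁗) and absorb the exponents. [folklore] -/
theorem stabilityOfProvableSymmetry_iff_proofsToDistEquiv : (∃ c : ℕ, ∀ (n t : ℕ) (C : PICircuit ℂ (Fin n × Fin n)), (∀ σ : Equiv.Perm (Fin n), HasPCProofOfSize (C.rename fun x : Fin n × Fin n => σ • x) C t) → ∃ (G : Type) (_ : Fintype G) (D : LabelledArithCircuit ℂ (Fin n × Fin n) Unit G), D.IsSymmetric (Equiv.Perm (Fin n)) ∧ D.eval (D.output ()) = C.eval ∧ Fintype.card G ≤ (C.size + t + n + 2) ^ c) ↔ (∃ c : ℕ, ∀ (n t : ℕ) (C : PICircuit ℂ (Fin n × Fin n)), (∀ σ : Equiv.Perm (Fin n), HasPCProofOfSize (C.rename fun x : Fin n × Fin n => σ • x) C t) → ∃ C' : PICircuit ℂ (Fin n × Fin n), C'.eval = C.eval ∧ C'.size ≤ (C.size + t + n + 2) ^ c ∧ ∀ σ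 : Equiv.Perm (Fin n), (pfSystem ℂ (Fin n × Fin n)).Provable (C'.rename fun x : Fin n × Fin n => σ • x).unfold C'.unfold ⊤ (fun s => if s = PIAxiom.A6 then 0 else ⊤)) := by
  constructor
  · intro hL
    obtain ⟨c, hc⟩ := proofsToACEquiv_of_stabilityOfProvableSymmetry hL
    refine ⟨c, fun n t C hC => ?_⟩
    obtain ⟨C', hev, hsize, hpf⟩ := hc n t C hC
    refine ⟨C', hev, hsize, fun σ => (hpf σ).mono le_rfl fun s => ?_⟩
    by_cases h6 : s = PIAxiom.A6
    · subst h6; simp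
    · simp [h6]
  · rintro ⟨c₂, h₂⟩
    obtain ⟨c₃, h₃⟩ := stabilityAtDistEquiv
    refine ⟨(c₂ + 2) * c₃, fun n t C hC => ?_⟩
    obtain ⟨C', hC'eval, hC'size, hC'pf⟩ := h₂ n t C hC
    obtain ⟨G, hG, D, hDsym, hDeval, hDcard⟩ := h₃ n C' hC'pf
    refine ⟨G, hG, D, hDsym, hDeval.trans hC'eval, ?_⟩
    calc Fintype.card G ≤ (C'.size + n + 2) ^ c₃ := hDcard
      _ ≤ ((C.size + t + n + 2) ^ c₂ + n + 2) ^ c₃ := Nat.pow_le_pow_left (by omega) _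
      _ ≤ (C.size + t + n + 2) ^ ((c₂ + 2) * c₃) := ACStability.poly_absorb' c₂ c₃ _ t n C.one_le_size

end Summit.ValiantsHypothesis.ValiantsHypothesis.Theorems
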